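import Mathlib.MeasureTheory.Integral.Bochner.Set
import Literature.Analysis.FluidPDE.RadialTestIBP
import Literature.Analysis.FluidPDE.SverakLandauConformalCalc
import HarnessLib

/-!
# Šverák's classification of `(−1)`-homogeneous steady Navier–Stokes flows — `2 + f = 2e^φ`

Analysis/FluidPDE support file of the series `SverakLandau*` proving the named fact
`Literature.Analysis.FluidPDE.Sverak2011_landauClassification` (V. Šverák, J. Math. Sci. 179
(2011) = arXiv:math/0604550, Thm. 1).

Šverák, §4 between Lemma 1 and (E4): "Integrating (E2) over `S²` … we see that `c = 0`", then
with `w = 2 − Δφ = 2 + f`, "`−Δw + div(∇φ w) = 0`.  The solutions of this equation are well-known: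
they are functions of the form `c₁e^φ` … Integrating `w` over the sphere we see that `c₁ > 0` …
changing `φ` by a constant … `−Δφ + 2 = 2e^φ`" ((E4)).  In the `ℝ³ ∖ {0}` rendering of the series
(integrals over `S²` ↦ integrals over `ℝ³` against radial bumps `χ(|x|)`; the tree's
`integral_radial_mul_divergence` kills divergences of fields tangent to spheres):

* `Sverak2011.integral_bump_mul_divergence_eq_zero` — `∫ χ(|x|) div W = 0` for `W ∈ C¹` tangent to
  spheres on the support shell;
* `Sverak2011.conformal_setup` — regularisation of `u`, `|x|⁻²`, `Φ` around a shell and the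
  relations they satisfy there;
* `Sverak2011.exists_conformal_potential` — **for the data of Theorem 1 there is `Φ`, smooth and
  `0`-homogeneous on `{x ≠ 0}`, with `∇Φ = u − (⟪x, u⟫/|x|²)x` and `2 + ⟪x, u(x)⟫ = 2e^{Φ(x)}`**
  (`k₀ = 0`; `∇(2 + F) = (2 + F)∇Φ` pointwise from `∫ χ e^{−Φ}|Y|² = 0`; `(2 + F)e^{−Φ} ≡ c₁` on
  the connected `{x ≠ 0}`; `c₁ > 0`; shift `Φ` by `log(c₁/2)`).

## References

* V. Šverák, *On Landau's solutions of the Navier–Stokes equations*, J. Math. Sci. 179 (2011)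
  208–228, arXiv:math/0604550, §4, (E2)–(E4). [`Sverak2011`]
-/

noncomputable section

open Set Filter Metric MeasureTheory
open scoped Topology BigOperators ContDiff Laplacian RealInnerProductSpace

namespace Literature.Analysis.FluidPDE

namespace Sverak2011

/-! ### Radial bumps -/

/-- `x ↦ χ(|x|)` has compact support when `χ` is a bump on `ℝ`. [folklore] -/
theorem hasCompactSupport_bump_norm {c : ℝ} (χ : ContDiffBump c) :
    HasCompactSupport fun x : EuclideanSpace ℝ (Fin 3) => χ ‖x‖ := by
  refine HasCompactSupport.intro (isCompact_closedBall (0 : EuclideanSpace ℝ (Fin 3)) (|c| + χ.rOut))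
    fun x hx => ?_
  apply χ.zero_of_le_dist
  rw [mem_closedBall, dist_zero_right] at hx
  rw [Real.dist_eq]
  have : |c| + χ.rOut < ‖x‖ := lt_of_not_ge hx
  have h1 : ‖x‖ - c ≥ ‖x‖ - |c| := by linarith [le_abs_self c]
  have h2 := χ.rOut_pos
  rw [abs_of_pos (by linarith [abs_nonneg c])]
  linarith

/-- Where the derivative of a bump is nonzero, we are in its topological support. [folklore] -/
theorem mem_tsupport_of_deriv_ne_zero {c : ℝ} (χ : ContDiffBump c) {r : ℝ} (hr : deriv χ r ≠ 0) :
    r ∈ tsupport χ := by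
  by_contra h
  apply hr
  rw [(notMem_tsupport_iff_eventuallyEq.mp h).deriv_eq]
  exact deriv_const r 0

/-- **Divergences of fields tangent to spheres integrate to zero against radial bumps**: for
`W ∈ C¹(ℝ³; ℝ³)` with `⟪x, W x⟫ = 0` whenever `|x| ∈ tsupport χ` (`χ` a bump supported in
`(0, ∞)`), `∫ χ(|x|) div W(x) dx = 0` — the bulk form of `∫_{S²} div_{S²} = 0` (tree:
`integral_radial_mul_divergence`). [folklore] -/
theorem integral_bump_mul_divergence_eq_zero {c : ℝ} (χ : ContDiffBump c)
    (hχ : χ.rOut < c) {W : EuclideanSpace ℝ (Fin 3) → EuclideanSpace ℝ (Fin 3)} (hW : ContDiff ℝ 1 W)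
    (htan : ∀ x : EuclideanSpace ℝ (Fin 3), ‖x‖ ∈ tsupport χ → ⟪x, W x⟫ = 0) :
    ∫ x, χ ‖x‖ * VectorCalculus.divergence W x = 0 := by
  have hsupp : tsupport χ ⊆ Ioi 0 := by
    rw [χ.tsupport_eq]; intro r hr
    rw [mem_closedBall, Real.dist_eq] at hr
    have := abs_sub_lt_iff.mp (lt_of_le_of_lt hr hχ)
    exact show 0 < r by linarith [this.2]
  have h := integral_radial_mul_divergence (volume : Measure (EuclideanSpace ℝ (Fin 3))) hW
    χ.contDiff χ.hasCompactSupport hsupp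
  unfold VectorCalculus.divergence
  rw [h, neg_eq_zero]
  refine integral_eq_zero_of_ae (ae_of_all _ fun x => ?_)
  show deriv χ ‖x‖ * ⟪‖x‖⁻¹ • x, W x⟫ = 0
  by_cases hd : deriv χ ‖x‖ = 0
  · rw [hd, zero_mul]
  · rw [inner_smul_left, RCLike.conj_to_real, htan x (mem_tsupport_of_deriv_ne_zero χ hd),
      mul_zero, mul_zero]

/-! ### The regularised setup around a shell -/

variable {u : EuclideanSpace ℝ (Fin 3) → EuclideanSpace ℝ (Fin 3)} {p : EuclideanSpace ℝ (Fin 3) → ℝ}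

/-- **Regularised setup around the shell `{c/4 < |y|}`.**  Given the data of Theorem 1, a potential
`Φ` of the tangential field and the pressure-free `f`-equation with constant `k₀`, there are
globally smooth `U = u`, `R = |y|⁻²`, `Φr = Φ` on `{c/4 ≤ |y|}` satisfying on `{c/4 < |y|}`:
Euler's relation, `div U = 0`, `R|y|² = 1`, the `f`-equation for `F̃ = ⟪y, U⟫`, and
`∇Φr = U − F̃R y`. [folklore] -/
theorem conformal_setup (hu : ContDiffOn ℝ ∞ u {x | x ≠ 0}) (hp : ContDiffOn ℝ ∞ p {x | x ≠ 0})
    (hns : ∀ x, x ≠ 0 → -(Δ u) x + convect u u x + gradient p x = 0)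
    (hdiv : ∀ x, x ≠ 0 → VectorCalculus.divergence u x = 0)
    (hhom : ∀ (t : ℝ) (x : EuclideanSpace ℝ (Fin 3)), 0 < t → x ≠ 0 → t • u (t • x) = u x)
    {Φ : EuclideanSpace ℝ (Fin 3) → ℝ} (hΦs : ContDiffOn ℝ ∞ Φ {x | x ≠ 0})
    (hΦ : ∀ x : EuclideanSpace ℝ (Fin 3), x ≠ 0 →
      HasFDerivAt Φ (innerSL ℝ (u x - (⟪x, u x⟫ / ‖x‖ ^ 2) • x)) x)
    {k₀ : ℝ} (hFeq : ∀ x : EuclideanSpace ℝ (Fin 3), x ≠ 0 →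
      (∑ i, x i ^ 2) * (-∑ l, pderiv l (pderiv l fun z => ∑ i, z i * u z i) x +
        ∑ l, u x l * pderiv l (fun z => ∑ i, z i * u z i) x) =
      (∑ i, x i * u x i) ^ 2 + 2 * (∑ i, x i * u x i) + 2 * k₀)
    {c : ℝ} (hc : 0 < c) :
    ∃ U : EuclideanSpace ℝ (Fin 3) → EuclideanSpace ℝ (Fin 3), ∃ R Φr : EuclideanSpace ℝ (Fin 3) → ℝ,
      ContDiff ℝ ∞ U ∧ ContDiff ℝ ∞ R ∧ ContDiff ℝ ∞ Φr ∧
      (∀ y, c / 4 ≤ ‖y‖ → U y = u y) ∧ (∀ y, c / 4 ≤ ‖y‖ → R y = (∑ i, y i ^ 2)⁻¹) ∧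
      (∀ y, c / 4 ≤ ‖y‖ → Φr y = Φ y) ∧
      (∀ y ∈ {y : EuclideanSpace ℝ (Fin 3) | c / 4 < ‖y‖}, fderiv ℝ U y y = -U y) ∧
      (∀ y ∈ {y : EuclideanSpace ℝ (Fin 3) | c / 4 < ‖y‖}, VectorCalculus.divergence U y = 0) ∧
      (∀ y ∈ {y : EuclideanSpace ℝ (Fin 3) | c / 4 < ‖y‖}, R y * ∑ i, y i ^ 2 = 1) ∧
      (∀ y ∈ {y : EuclideanSpace ℝ (Fin 3) | c / 4 < ‖y‖},
        (∑ i, y i ^ 2) * (-∑ l, pderiv l (pderiv l fun z => ∑ i, z i * U z i) y +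
          ∑ l, U y l * pderiv l (fun z => ∑ i, z i * U z i) y) =
        (∑ i, y i * U y i) ^ 2 + 2 * (∑ i, y i * U y i) + 2 * k₀) ∧
      (∀ y ∈ {y : EuclideanSpace ℝ (Fin 3) | c / 4 < ‖y‖},
        gradient Φr y = U y - ((∑ j, y j * U y j) * R y) • y) := by
  have hΩ : IsOpen {x : EuclideanSpace ℝ (Fin 3) | x ≠ 0} := isOpen_compl_singleton
  have hδ : 0 < c / 4 := by positivity
  obtain ⟨U, hU, hUu⟩ := exists_contDiff_eq_of_contDiffOn hu hδ
  obtain ⟨P, -, hPp⟩ := exists_contDiff_eq_of_contDiffOn hp hδ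
  have hRo : ContDiffOn ℝ ∞ (fun y : EuclideanSpace ℝ (Fin 3) => (∑ i, y i ^ 2)⁻¹) {y | y ≠ 0} := by
    refine (ContDiff.sum fun i _ => (contDiff_coord i).pow 2).contDiffOn.inv fun y hy => ?_
    rw [← EuclideanSpace.real_norm_sq_eq]; exact pow_ne_zero 2 (norm_ne_zero_iff.mpr hy)
  obtain ⟨R, hR, hRr⟩ := exists_contDiff_eq_of_contDiffOn hRo hδ
  obtain ⟨Φr, hΦr, hΦrΦ⟩ := exists_contDiff_eq_of_contDiffOn hΦs hδ
  obtain ⟨-, hdivU, hEuU⟩ := transfer_equations hδ hu hns hdiv hhom hUu hPp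
  have hS := isOpen_lt_norm (c / 4)
  have huU : EqOn u U {y | c / 4 < ‖y‖} := fun y hy => (hUu y (le_of_lt hy)).symm
  have hFF : EqOn (fun z => ∑ i, z i * u z i) (fun z => ∑ i, z i * U z i) {y | c / 4 < ‖y‖} :=
    fun y hy => by simp only [huU hy]
  refine ⟨U, R, Φr, hU, hR, hΦr, hUu, hRr, hΦrΦ, hEuU, hdivU, fun y hy => ?_, fun y hy => ?_,
    fun y hy => ?_⟩
  · rw [hRr y (le_of_lt hy), inv_mul_cancel₀]
    rw [← EuclideanSpace.real_norm_sq_eq]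
    exact pow_ne_zero 2 (norm_ne_zero_iff.mpr (ne_zero_of_lt_norm hδ hy))
  · have := hFeq y (ne_zero_of_lt_norm hδ hy)
    simpa only [pderiv_pderiv_eqOn hS hFF _ _ hy, pderiv_eqOn hS hFF _ hy, huU hy] using this
  · have hy0 := ne_zero_of_lt_norm hδ hy
    have hev : Φr =ᶠ[𝓝 y] Φ := eventuallyEq_of_eq_of_le_norm hΦrΦ hy
    rw [hev.gradient_eq]
    have hg : gradient Φ y = u y - (⟪y, u y⟫ / ‖y‖ ^ 2) • y := by
      have h1 := hΦ y hy0
      have h2 : innerSL ℝ (u y - (⟪y, u y⟫ / ‖y‖ ^ 2) • y) =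
          InnerProductSpace.toDual ℝ _ (u y - (⟪y, u y⟫ / ‖y‖ ^ 2) • y) := rfl
      rw [h2] at h1
      exact (hasGradientAt_iff_hasFDerivAt.mpr h1).gradient
    have e1 : ⟪y, U y⟫ = ∑ j, y j * U y j := by
      simp only [PiLp.inner_apply, RCLike.inner_apply, conj_trivial]
      exact Finset.sum_congr rfl fun j _ => mul_comm _ _
    rw [hg, huU hy, hRr y (le_of_lt hy), EuclideanSpace.real_norm_sq_eq, div_eq_mul_inv, e1]

/-! ### The main step -/

/-- **`2 + f = 2e^φ`** (Šverák 2011, §4, from Lemma 1 to (E4)).  For the data of Theorem 1 there is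
a potential `Φ`, smooth and `0`-homogeneous on `{x ≠ 0}`, of the tangential field,
`DΦ(x) = ⟪u(x) − (⟪x, u x⟫/|x|²)x, ·⟫`, normalised so that `2 + ⟪x, u(x)⟫ = 2e^{Φ(x)}` —
Šverák's `f = 2e^φ − 2` ((4.7)₂ / `w = 2e^φ`). [cite: Sverak2011, §4 (E2)–(E4)] -/
theorem exists_conformal_potential (hu : ContDiffOn ℝ ∞ u {x | x ≠ 0})
    (hp : ContDiffOn ℝ ∞ p {x | x ≠ 0})
    (hns : ∀ x, x ≠ 0 → -(Δ u) x + convect u u x + gradient p x = 0)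
    (hdiv : ∀ x, x ≠ 0 → VectorCalculus.divergence u x = 0)
    (hhom : ∀ (t : ℝ) (x : EuclideanSpace ℝ (Fin 3)), 0 < t → x ≠ 0 → t • u (t • x) = u x) :
    ∃ Φ : EuclideanSpace ℝ (Fin 3) → ℝ, ContDiffOn ℝ ∞ Φ {x | x ≠ 0} ∧
      (∀ x : EuclideanSpace ℝ (Fin 3), x ≠ 0 →
        HasFDerivAt Φ (innerSL ℝ (u x - (⟪x, u x⟫ / ‖x‖ ^ 2) • x)) x) ∧
      (∀ (t : ℝ) (x : EuclideanSpace ℝ (Fin 3)), 0 < t → x ≠ 0 → Φ (t • x) = Φ x) ∧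
      ∀ x : EuclideanSpace ℝ (Fin 3), x ≠ 0 → 2 + ⟪x, u x⟫ = 2 * Real.exp (Φ x) := by
  have hΩ : IsOpen {x : EuclideanSpace ℝ (Fin 3) | x ≠ 0} := isOpen_compl_singleton
  obtain ⟨Φ, hΦs, hΦ, hΦh⟩ := exists_tangential_potential hu hp hns hdiv hhom
  obtain ⟨k₀, -, -, hFeq⟩ := bernoulliK_const_and_radVort_eq_zero hu hp hns hdiv hhom rfl rfl rfl
  -- abbreviations for the true radial profile and tangential field
  have hFin : ∀ x : EuclideanSpace ℝ (Fin 3), ⟪x, u x⟫ = ∑ i, x i * u x i := fun x => by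
    simp only [PiLp.inner_apply, RCLike.inner_apply, conj_trivial]
    exact Finset.sum_congr rfl fun j _ => mul_comm _ _
  ------------------------------------------------------------------
  -- Step 1: `k₀ = 0` (integrate against the bump at radius `1`)
  ------------------------------------------------------------------
  have hk₀ : k₀ = 0 := by
    obtain ⟨U, R, Φr, hU, hR, -, hUu, hRr, -, hEuU, hdivU, hR1, hFeqU, -⟩ :=
      conformal_setup hu hp hns hdiv hhom hΦs hΦ hFeq one_pos
    set χ : ContDiffBump (1 : ℝ) := ⟨1 / 4, 1 / 2, by norm_num, by norm_num⟩ with hχdef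
    have hχ : χ.rOut < 1 := by norm_num [hχdef]
    have hS := isOpen_lt_norm ((1 : ℝ) / 4)
    -- points with `|x| ∈ tsupport χ` lie in the shell
    have hmem : ∀ x : EuclideanSpace ℝ (Fin 3), ‖x‖ ∈ tsupport χ →
        x ∈ {y : EuclideanSpace ℝ (Fin 3) | (1 : ℝ) / 4 < ‖y‖} := by
      intro x hx
      rw [χ.tsupport_eq, mem_closedBall, Real.dist_eq] at hx
      have := abs_sub_le_iff.mp hx
      show (1 : ℝ) / 4 < ‖x‖
      norm_num [hχdef] at this ⊢; linarith [this.2]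
    have hχ0 : ∀ x : EuclideanSpace ℝ (Fin 3), x ∉ {y : EuclideanSpace ℝ (Fin 3) | (1 : ℝ) / 4 < ‖y‖} →
        χ ‖x‖ = 0 := by
      intro x hx
      apply χ.zero_of_le_dist
      simp only [mem_setOf_eq, not_lt] at hx
      rw [Real.dist_eq]; norm_num [hχdef]
      rw [abs_of_nonpos (by linarith)]; linarith
    set F : EuclideanSpace ℝ (Fin 3) → ℝ := fun y => ∑ i, y i * U y i with hFdef
    set Vt : EuclideanSpace ℝ (Fin 3) → EuclideanSpace ℝ (Fin 3) := fun y => U y - (F y * R y) • y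
      with hVdef
    have hFc : ContDiff ℝ ∞ F := contDiff_radial hU
    have hVc : ContDiff ℝ ∞ Vt := hU.sub ((hFc.mul hR).smul contDiff_id)
    have hcomb : ∀ y ∈ {y : EuclideanSpace ℝ (Fin 3) | (1 : ℝ) / 4 < ‖y‖}, 2 * k₀ * R y =
        -VectorCalculus.divergence (gradient F) y +
          VectorCalculus.divergence (fun y => F y • Vt y) y + 2 * VectorCalculus.divergence Vt y :=
      fun y hy => bernoulli_combination_on hU hR hS hEuU hdivU hR1 rfl rfl hFeqU hy
    -- the three divergence integrals vanish
    have hgradc : ContDiff ℝ 1 (gradient F) :=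
      (InnerProductSpace.toDual ℝ (EuclideanSpace ℝ (Fin 3))).symm.contDiff.comp
        (hFc.fderiv_right (m := 1) (by norm_cast))
    have I₁ : ∫ x, χ ‖x‖ * VectorCalculus.divergence (gradient F) x = 0 :=
      integral_bump_mul_divergence_eq_zero χ hχ hgradc fun x hx => by
        rw [real_inner_comm, inner_gradient_left]
        exact fderiv_radial_self_on hU hEuU rfl (hmem x hx)
    have I₂ : ∫ x, χ ‖x‖ * VectorCalculus.divergence (fun y => F y • Vt y) x = 0 :=
      integral_bump_mul_divergence_eq_zero χ hχ ((hFc.smul hVc).of_le (by norm_cast))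
        fun x hx => by
          rw [inner_smul_right, inner_tangentialReg_on hR1 rfl rfl (hmem x hx), mul_zero]
    have I₃ : ∫ x, χ ‖x‖ * VectorCalculus.divergence Vt x = 0 :=
      integral_bump_mul_divergence_eq_zero χ hχ (hVc.of_le (by norm_cast))
        fun x hx => inner_tangentialReg_on hR1 rfl rfl (hmem x hx)
    -- hence `2k₀ ∫ χ(|x|) R(x) dx = 0`
    have hcs := hasCompactSupport_bump_norm χ
    have hχc : Continuous fun x : EuclideanSpace ℝ (Fin 3) => χ ‖x‖ := χ.continuous.comp continuous_norm
    have hint : ∀ {g : EuclideanSpace ℝ (Fin 3) → ℝ}, Continuous g →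
        Integrable (fun x => χ ‖x‖ * g x) := fun hg =>
      (hχc.mul hg).integrable_of_hasCompactSupport hcs.mul_right
    have hcd : ∀ {W : EuclideanSpace ℝ (Fin 3) → EuclideanSpace ℝ (Fin 3)}, ContDiff ℝ 1 W →
        Continuous (VectorCalculus.divergence W) := fun hW =>
      continuous_divergence (hW.continuous_fderiv one_ne_zero)
    have hzero : ∫ x, χ ‖x‖ * (2 * k₀ * R x) = 0 := by
      have heq : (fun x => χ ‖x‖ * (2 * k₀ * R x)) = fun x =>
          -(χ ‖x‖ * VectorCalculus.divergence (gradient F) x) +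
          χ ‖x‖ * VectorCalculus.divergence (fun y => F y • Vt y) x +
          2 * (χ ‖x‖ * VectorCalculus.divergence Vt x) := by
        funext x
        by_cases hx : x ∈ {y : EuclideanSpace ℝ (Fin 3) | (1 : ℝ) / 4 < ‖y‖}
        · rw [hcomb x hx]; ring
        · rw [hχ0 x hx]; ring
      rw [heq, integral_add, integral_add, integral_neg, integral_const_mul, I₁, I₂, I₃]
      · ring
      · exact (hint (hcd hgradc)).neg
      · exact hint (hcd ((hFc.smul hVc).of_le (by norm_cast)))
      · exact ((hint (hcd hgradc)).neg).add (hint (hcd ((hFc.smul hVc).of_le (by norm_cast))))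
      · exact (hint (hcd (hVc.of_le (by norm_cast)))).const_mul 2
    -- and `∫ χ(|x|) R(x) dx > 0`
    have hpos : 0 < ∫ x, χ ‖x‖ * R x := by
      have hnn : ∀ x : EuclideanSpace ℝ (Fin 3), 0 ≤ χ ‖x‖ * R x := by
        intro x
        by_cases hx : x ∈ {y : EuclideanSpace ℝ (Fin 3) | (1 : ℝ) / 4 < ‖y‖}
        · refine mul_nonneg χ.nonneg ?_
          rw [hRr x (le_of_lt hx)]; positivity
        · rw [hχ0 x hx, zero_mul]
      have he : (EuclideanSpace.single 0 1 : EuclideanSpace ℝ (Fin 3)) ∈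
          {y : EuclideanSpace ℝ (Fin 3) | (1 : ℝ) / 4 < ‖y‖} := by
        show (1 : ℝ) / 4 < ‖(EuclideanSpace.single 0 1 : EuclideanSpace ℝ (Fin 3))‖
        rw [show ‖(EuclideanSpace.single 0 1 : EuclideanSpace ℝ (Fin 3))‖ = 1 by simp]; norm_num
      refine (hχc.mul hR.continuous).integral_pos_of_hasCompactSupport_nonneg_nonzero
        hcs.mul_right hnn (x := EuclideanSpace.single 0 1) ?_
      have hn1 : ‖(EuclideanSpace.single 0 1 : EuclideanSpace ℝ (Fin 3))‖ = 1 := by simp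
      have h1 : χ ‖(EuclideanSpace.single 0 1 : EuclideanSpace ℝ (Fin 3))‖ = 1 := by
        rw [hn1]
        exact χ.one_of_mem_closedBall (mem_closedBall_self χ.rIn_pos.le)
      have h2 : R (EuclideanSpace.single 0 1) = 1 := by
        have := hR1 _ he
        rwa [← EuclideanSpace.real_norm_sq_eq, hn1, one_pow, mul_one] at this
      rw [h1, h2]; norm_num
    have : 2 * k₀ * ∫ x, χ ‖x‖ * R x = 0 := by
      have hfun : (fun x : EuclideanSpace ℝ (Fin 3) => χ ‖x‖ * (2 * k₀ * R x)) =
          fun x => (2 * k₀) * (χ ‖x‖ * R x) := by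
        funext x; ring
      rw [← integral_const_mul, ← hfun]
      exact hzero
    rcases mul_eq_zero.mp this with h | h
    · linarith
    · exact absurd h hpos.ne'
  ------------------------------------------------------------------
  -- Step 2: `∇F = (2 + F) V` pointwise on `{x ≠ 0}`
  ------------------------------------------------------------------
  have hgradF : ∀ x₀ : EuclideanSpace ℝ (Fin 3), x₀ ≠ 0 →
      gradient (fun z => ∑ i, z i * u z i) x₀ =
        (2 + ∑ i, x₀ i * u x₀ i) • (u x₀ - (⟪x₀, u x₀⟫ / ‖x₀‖ ^ 2) • x₀) := by
    intro x₀ hx₀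
    have hc : 0 < ‖x₀‖ := norm_pos_iff.mpr hx₀
    obtain ⟨U, R, Φr, hU, hR, hΦr, hUu, hRr, hΦrΦ, hEuU, hdivU, hR1, hFeqU, hgradΦ⟩ :=
      conformal_setup hu hp hns hdiv hhom hΦs hΦ hFeq hc
    rw [hk₀] at hFeqU
    set χ : ContDiffBump (‖x₀‖ : ℝ) := ⟨‖x₀‖ / 4, ‖x₀‖ / 2, by positivity, by linarith⟩ with hχdef
    have hχ : χ.rOut < ‖x₀‖ := by show ‖x₀‖ / 2 < ‖x₀‖; linarith
    have hS := isOpen_lt_norm (‖x₀‖ / 4)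
    have hmem : ∀ x : EuclideanSpace ℝ (Fin 3), ‖x‖ ∈ tsupport χ →
        x ∈ {y : EuclideanSpace ℝ (Fin 3) | ‖x₀‖ / 4 < ‖y‖} := by
      intro x hx
      rw [χ.tsupport_eq, mem_closedBall, Real.dist_eq] at hx
      have := abs_sub_le_iff.mp hx
      show ‖x₀‖ / 4 < ‖x‖
      have h2 : ‖x₀‖ - ‖x‖ ≤ ‖x₀‖ / 2 := this.2
      linarith
    have hχ0 : ∀ x : EuclideanSpace ℝ (Fin 3), x ∉ {y : EuclideanSpace ℝ (Fin 3) | ‖x₀‖ / 4 < ‖y‖} →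
        χ ‖x‖ = 0 := by
      intro x hx
      apply χ.zero_of_le_dist
      simp only [mem_setOf_eq, not_lt] at hx
      rw [Real.dist_eq]
      show ‖x₀‖ / 2 ≤ |‖x‖ - ‖x₀‖|
      rw [abs_of_nonpos (by linarith)]; linarith
    set F : EuclideanSpace ℝ (Fin 3) → ℝ := fun y => ∑ i, y i * U y i with hFdef
    set Vt : EuclideanSpace ℝ (Fin 3) → EuclideanSpace ℝ (Fin 3) := fun y => U y - (F y * R y) • y
      with hVdef
    set Y : EuclideanSpace ℝ (Fin 3) → EuclideanSpace ℝ (Fin 3) :=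
      fun y => gradient F y - (2 + F y) • Vt y with hYdef
    set C : EuclideanSpace ℝ (Fin 3) → ℝ := fun y => (2 + F y) * Real.exp (-Φr y) with hCdef
    have hFc : ContDiff ℝ ∞ F := contDiff_radial hU
    have hVc : ContDiff ℝ ∞ Vt := hU.sub ((hFc.mul hR).smul contDiff_id)
    have hgradc : ContDiff ℝ ∞ (gradient F) :=
      (InnerProductSpace.toDual ℝ (EuclideanSpace ℝ (Fin 3))).symm.contDiff.comp
        (hFc.fderiv_right (m := ∞) (by norm_cast))
    have hYc : ContDiff ℝ ∞ Y := hgradc.sub ((contDiff_const.add hFc).smul hVc)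
    have hCc : ContDiff ℝ ∞ C := (contDiff_const.add hFc).mul hΦr.neg.exp
    -- `∫ χ(|x|) div (C Y) = 0` and `div(C Y) = e^{−Φr}|Y|²` on the shell
    have I : ∫ x, χ ‖x‖ * VectorCalculus.divergence (fun y => C y • Y y) x = 0 :=
      integral_bump_mul_divergence_eq_zero χ hχ ((hCc.smul hYc).of_le (by norm_cast))
        fun x hx => by
          rw [inner_smul_right, inner_conformalY_on hU hEuU hR1 rfl rfl rfl (hmem x hx), mul_zero]
    have hdivCY : ∀ y ∈ {y : EuclideanSpace ℝ (Fin 3) | ‖x₀‖ / 4 < ‖y‖},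
        VectorCalculus.divergence (fun y => C y • Y y) y = Real.exp (-Φr y) * ‖Y y‖ ^ 2 :=
      fun y hy => divergence_smul_conformalY_on hU hR hΦr hS hEuU hdivU hR1 rfl rfl hFeqU hgradΦ
        rfl rfl hy
    have heq : (fun x => χ ‖x‖ * VectorCalculus.divergence (fun y => C y • Y y) x) =
        fun x => χ ‖x‖ * (Real.exp (-Φr x) * ‖Y x‖ ^ 2) := by
      funext x
      by_cases hx : x ∈ {y : EuclideanSpace ℝ (Fin 3) | ‖x₀‖ / 4 < ‖y‖}
      · rw [hdivCY x hx]
      · rw [hχ0 x hx, zero_mul, zero_mul]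
    rw [heq] at I
    -- a continuous nonnegative compactly supported function with zero integral vanishes at `x₀`
    have hcs := hasCompactSupport_bump_norm χ
    have hχc : Continuous fun x : EuclideanSpace ℝ (Fin 3) => χ ‖x‖ := χ.continuous.comp continuous_norm
    have hcont : Continuous fun x => χ ‖x‖ * (Real.exp (-Φr x) * ‖Y x‖ ^ 2) :=
      hχc.mul ((hΦr.continuous.neg.rexp).mul ((hYc.continuous.norm).pow 2))
    have hnn : ∀ x, 0 ≤ χ ‖x‖ * (Real.exp (-Φr x) * ‖Y x‖ ^ 2) := fun x =>
      mul_nonneg χ.nonneg (mul_nonneg (Real.exp_pos _).le (sq_nonneg _))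
    have hYx₀ : Y x₀ = 0 := by
      by_contra hne
      have hval : χ ‖x₀‖ * (Real.exp (-Φr x₀) * ‖Y x₀‖ ^ 2) ≠ 0 := by
        have h1 : χ ‖x₀‖ = 1 := χ.one_of_mem_closedBall (mem_closedBall_self χ.rIn_pos.le)
        rw [h1, one_mul]
        exact mul_ne_zero (Real.exp_pos _).ne' (pow_ne_zero 2 (norm_ne_zero_iff.mpr hne))
      have := hcont.integral_pos_of_hasCompactSupport_nonneg_nonzero
        (μ := (volume : Measure (EuclideanSpace ℝ (Fin 3)))) hcs.mul_right hnn hval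
      linarith
    -- transfer back to the true fields at `x₀`
    have hx₀S : x₀ ∈ {y : EuclideanSpace ℝ (Fin 3) | ‖x₀‖ / 4 < ‖y‖} := by
      show ‖x₀‖ / 4 < ‖x₀‖; linarith
    have huU : EqOn u U {y | ‖x₀‖ / 4 < ‖y‖} := fun y hy => (hUu y (le_of_lt hy)).symm
    have hFF : (fun z => ∑ i, z i * u z i) =ᶠ[𝓝 x₀] F :=
      Filter.eventuallyEq_of_mem (hS.mem_nhds hx₀S) fun y hy => by simp only [hFdef, huU hy]
    have hY0 : gradient F x₀ = (2 + F x₀) • Vt x₀ := sub_eq_zero.mp hYx₀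
    rw [hFF.gradient_eq, hY0, hFin x₀]
    simp only [hFdef, hVdef, huU hx₀S, hRr x₀ (le_of_lt hx₀S), EuclideanSpace.real_norm_sq_eq,
      div_eq_mul_inv]
  ------------------------------------------------------------------
  -- Step 3: `(2 + F) e^{−Φ}` is constant on `{x ≠ 0}`
  ------------------------------------------------------------------
  set Cf : EuclideanSpace ℝ (Fin 3) → ℝ := fun x => (2 + ∑ i, x i * u x i) * Real.exp (-Φ x)
    with hCf
  have hFs : ContDiffOn ℝ ∞ (fun z : EuclideanSpace ℝ (Fin 3) => ∑ i, z i * u z i) {x | x ≠ 0} :=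
    ContDiffOn.sum fun i _ => (contDiff_coord i).contDiffOn.mul
      ((contDiffOn_euclidean (𝕜 := ℝ)).1 hu i)
  have hCderiv : ∀ x : EuclideanSpace ℝ (Fin 3), x ≠ 0 → HasFDerivAt Cf (0 : EuclideanSpace ℝ (Fin 3) →L[ℝ] ℝ) x := by
    intro x hx
    have hFd : DifferentiableAt ℝ (fun z : EuclideanSpace ℝ (Fin 3) => ∑ i, z i * u z i) x :=
      (hFs.contDiffAt (hΩ.mem_nhds hx)).differentiableAt (by simp)
    have h1 : HasFDerivAt (fun z : EuclideanSpace ℝ (Fin 3) => 2 + ∑ i, z i * u z i)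
        (fderiv ℝ (fun z : EuclideanSpace ℝ (Fin 3) => ∑ i, z i * u z i) x) x :=
      hFd.hasFDerivAt.const_add 2
    have h2 : HasFDerivAt (fun z => Real.exp (-Φ z))
        (Real.exp (-Φ x) • -(innerSL ℝ (u x - (⟪x, u x⟫ / ‖x‖ ^ 2) • x))) x :=
      ((hΦ x hx).neg).exp
    have h3 := h1.mul h2
    refine h3.congr_fderiv ?_
    ext w
    rw [show ((0 : EuclideanSpace ℝ (Fin 3) →L[ℝ] ℝ) w) = 0 from rfl]
    have hgw : fderiv ℝ (fun z : EuclideanSpace ℝ (Fin 3) => ∑ i, z i * u z i) x w =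
        ⟪gradient (fun z : EuclideanSpace ℝ (Fin 3) => ∑ i, z i * u z i) x, w⟫ :=
      (inner_gradient_left).symm
    simp only [FunLike.coe_add, FunLike.coe_smul, FunLike.coe_neg, Pi.add_apply, Pi.smul_apply,
      Pi.neg_apply, smul_eq_mul, innerSL_apply_apply, hgw,
      hgradF x hx, inner_smul_left, RCLike.conj_to_real]
    ring
  obtain ⟨c₁, hc₁⟩ : ∃ c₁ : ℝ, ∀ x ∈ {x : EuclideanSpace ℝ (Fin 3) | x ≠ 0}, Cf x = c₁ :=
    hΩ.exists_is_const_of_fderiv_eq_zero isPreconnected_compl_zero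
      (fun x hx => (hCderiv x hx).differentiableAt.differentiableWithinAt)
      (fun x hx => (hCderiv x hx).fderiv)
  have hrel : ∀ x : EuclideanSpace ℝ (Fin 3), x ≠ 0 → 2 + ∑ i, x i * u x i = c₁ * Real.exp (Φ x) := by
    intro x hx
    have := hc₁ x hx
    simp only [hCf] at this
    have he : Real.exp (-Φ x) * Real.exp (Φ x) = 1 := by rw [← Real.exp_add]; simp
    calc 2 + ∑ i, x i * u x i = (2 + ∑ i, x i * u x i) * (Real.exp (-Φ x) * Real.exp (Φ x)) := by
          rw [he, mul_one]
      _ = c₁ * Real.exp (Φ x) := by rw [← mul_assoc, this]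
  ------------------------------------------------------------------
  -- Step 4: `c₁ > 0`
  ------------------------------------------------------------------
  have hc₁pos : 0 < c₁ := by
    by_contra hle
    push Not at hle
    have hFle : ∀ x : EuclideanSpace ℝ (Fin 3), x ≠ 0 → ∑ i, x i * u x i ≤ -2 := by
      intro x hx
      have := hrel x hx
      have : c₁ * Real.exp (Φ x) ≤ 0 := mul_nonpos_of_nonpos_of_nonneg hle (Real.exp_pos _).le
      linarith
    -- integrate `χ(|x|) F R = −χ(|x|) div Ṽ` at radius `1`
    obtain ⟨U, R, Φr, hU, hR, -, hUu, hRr, -, hEuU, hdivU, hR1, -, -⟩ :=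
      conformal_setup hu hp hns hdiv hhom hΦs hΦ hFeq one_pos
    set χ : ContDiffBump (1 : ℝ) := ⟨1 / 4, 1 / 2, by norm_num, by norm_num⟩ with hχdef
    have hχ : χ.rOut < 1 := by norm_num [hχdef]
    have hS := isOpen_lt_norm ((1 : ℝ) / 4)
    have hmem : ∀ x : EuclideanSpace ℝ (Fin 3), ‖x‖ ∈ tsupport χ →
        x ∈ {y : EuclideanSpace ℝ (Fin 3) | (1 : ℝ) / 4 < ‖y‖} := by
      intro x hx
      rw [χ.tsupport_eq, mem_closedBall, Real.dist_eq] at hx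
      have := abs_sub_le_iff.mp hx
      show (1 : ℝ) / 4 < ‖x‖
      norm_num [hχdef] at this ⊢; linarith [this.2]
    have hχ0 : ∀ x : EuclideanSpace ℝ (Fin 3), x ∉ {y : EuclideanSpace ℝ (Fin 3) | (1 : ℝ) / 4 < ‖y‖} →
        χ ‖x‖ = 0 := by
      intro x hx
      apply χ.zero_of_le_dist
      simp only [mem_setOf_eq, not_lt] at hx
      rw [Real.dist_eq]; norm_num [hχdef]
      rw [abs_of_nonpos (by linarith)]; linarith
    set F : EuclideanSpace ℝ (Fin 3) → ℝ := fun y => ∑ i, y i * U y i with hFdef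
    set Vt : EuclideanSpace ℝ (Fin 3) → EuclideanSpace ℝ (Fin 3) := fun y => U y - (F y * R y) • y
      with hVdef
    have hFc : ContDiff ℝ ∞ F := contDiff_radial hU
    have hVc : ContDiff ℝ ∞ Vt := hU.sub ((hFc.mul hR).smul contDiff_id)
    have I₃ : ∫ x, χ ‖x‖ * VectorCalculus.divergence Vt x = 0 :=
      integral_bump_mul_divergence_eq_zero χ hχ (hVc.of_le (by norm_cast))
        fun x hx => inner_tangentialReg_on hR1 rfl rfl (hmem x hx)
    have heq : (fun x => χ ‖x‖ * VectorCalculus.divergence Vt x) = fun x => -(χ ‖x‖ * (F x * R x)) := by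
      funext x
      by_cases hx : x ∈ {y : EuclideanSpace ℝ (Fin 3) | (1 : ℝ) / 4 < ‖y‖}
      · rw [divergence_tangentialReg_on hU hR hS hEuU hdivU hR1 rfl rfl hx]; ring
      · rw [hχ0 x hx]; ring
    rw [heq, integral_neg, neg_eq_zero] at I₃
    have hcs := hasCompactSupport_bump_norm χ
    have hχc : Continuous fun x : EuclideanSpace ℝ (Fin 3) => χ ‖x‖ := χ.continuous.comp continuous_norm
    have huU : EqOn u U {y | (1 : ℝ) / 4 < ‖y‖} := fun y hy => (hUu y (le_of_lt hy)).symm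
    -- `χ F R ≤ −2 χ R` everywhere, and `∫ χ R > 0`
    have hle2 : ∀ x, χ ‖x‖ * (F x * R x) ≤ -2 * (χ ‖x‖ * R x) := by
      intro x
      by_cases hx : x ∈ {y : EuclideanSpace ℝ (Fin 3) | (1 : ℝ) / 4 < ‖y‖}
      · have hRx : 0 ≤ R x := by rw [hRr x (le_of_lt hx)]; positivity
        have hFx : F x ≤ -2 := by
          have := hFle x (ne_zero_of_lt_norm (by norm_num) hx)
          simpa only [hFdef, huU hx] using this
        have hab : χ ‖x‖ * R x * (F x + 2) ≤ 0 :=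
          mul_nonpos_of_nonneg_of_nonpos (mul_nonneg χ.nonneg hRx) (by linarith)
        linarith [hab]
      · rw [hχ0 x hx]; simp
    have hpos : 0 < ∫ x, χ ‖x‖ * R x := by
      have hnn : ∀ x : EuclideanSpace ℝ (Fin 3), 0 ≤ χ ‖x‖ * R x := by
        intro x
        by_cases hx : x ∈ {y : EuclideanSpace ℝ (Fin 3) | (1 : ℝ) / 4 < ‖y‖}
        · refine mul_nonneg χ.nonneg ?_
          rw [hRr x (le_of_lt hx)]; positivity
        · rw [hχ0 x hx, zero_mul]
      have he : (EuclideanSpace.single 0 1 : EuclideanSpace ℝ (Fin 3)) ∈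
          {y : EuclideanSpace ℝ (Fin 3) | (1 : ℝ) / 4 < ‖y‖} := by
        show (1 : ℝ) / 4 < ‖(EuclideanSpace.single 0 1 : EuclideanSpace ℝ (Fin 3))‖
        rw [show ‖(EuclideanSpace.single 0 1 : EuclideanSpace ℝ (Fin 3))‖ = 1 by simp]; norm_num
      refine (hχc.mul hR.continuous).integral_pos_of_hasCompactSupport_nonneg_nonzero
        hcs.mul_right hnn (x := EuclideanSpace.single 0 1) ?_
      have hn1 : ‖(EuclideanSpace.single 0 1 : EuclideanSpace ℝ (Fin 3))‖ = 1 := by simp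
      have h1 : χ ‖(EuclideanSpace.single 0 1 : EuclideanSpace ℝ (Fin 3))‖ = 1 := by
        rw [hn1]
        exact χ.one_of_mem_closedBall (mem_closedBall_self χ.rIn_pos.le)
      have h2 : R (EuclideanSpace.single 0 1) = 1 := by
        have := hR1 _ he
        rwa [← EuclideanSpace.real_norm_sq_eq, hn1, one_pow, mul_one] at this
      rw [h1, h2]; norm_num
    have hintR : Integrable (fun x : EuclideanSpace ℝ (Fin 3) => χ ‖x‖ * R x) :=
      (hχc.mul hR.continuous).integrable_of_hasCompactSupport hcs.mul_right
    have hintFR : Integrable (fun x : EuclideanSpace ℝ (Fin 3) => χ ‖x‖ * (F x * R x)) :=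
      (hχc.mul (hFc.continuous.mul hR.continuous)).integrable_of_hasCompactSupport hcs.mul_right
    have hmono := integral_mono hintFR (hintR.const_mul (-2)) hle2
    rw [I₃, integral_const_mul] at hmono
    linarith
  ------------------------------------------------------------------
  -- Step 5: shift the potential
  ------------------------------------------------------------------
  refine ⟨fun x => Φ x + Real.log (c₁ / 2), hΦs.add contDiffOn_const,
    fun x hx => (hΦ x hx).add_const _, fun t x ht hx => by beta_reduce; rw [hΦh t x ht hx],
    fun x hx => ?_⟩
  rw [Real.exp_add, Real.exp_log (by positivity), hFin, hrel x hx]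
  ring

end Sverak2011

end Literature.Analysis.FluidPDE
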